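/-
Soloist programme `solo-KontsevichZagierPeriods-blind`, session 3.
KONTSEVICH–ZAGIER'S EQ. (1) COMPLETED, I: the subgraph representations of the two middle members
`2∫_{-1}^{1} √(1-x²) dx` and `∫_{-1}^{1} dx/√(1-x²)`, and the half-ellipse `≡` the disc.
-/
import Summits.KontsevichZagierPeriods.KontsevichZagierPeriods.Theorems.SoloBlindPiDisc
import HarnessLib

/-!
# Kontsevich–Zagier's eq. (1), I: the middle members as areas under algebraic graphs

*Periods*, eq. (1), lists four representations of `π`:
`∬_{x²+y²≤1} dx dy = 2∫_{-1}^{1} √(1-x²) dx = ∫_{-1}^{1} dx/√(1-x²) = ∫_{-∞}^{∞} dx/(1+x²)`.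
`SoloBlindPiDisc` proved the outer two equivalent (`kz_pi_disc`).  The two middle ones have
*algebraic, irrational* integrands, so — exactly as Kontsevich–Zagier prescribe in §1.1 ("the
integral of an algebraic function is the area under its graph") — we represent them with
`ℚ`-rational data as subgraph areas:

* `halfEllipseRep = E = [{0 < y, 4x² + y² ≤ 4}, 1]`, the region under `y = 2√(1-x²)`;
* `kzArcsine = {x² < 1, 0 < y, y²(1-x²) ≤ 1}`, the region under `y = 1/√(1-x²)` (its
  representation `A` is built in part II, where its integrability is transported along a chart).

## Main results (this file)

* `twoAtanHalfLine = T = [(0,∞), 2/(1+u²)]`, value `π`, a generator of `B(π)`;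
* `exists_ellipseChart`, `equivalent_halfEllipse_twoHalfDisc` — ONE move: the `ℚ`-linear chart
  `(x,y) ↦ (y/2, x)` (`|det| = 1/2`) carries `E` onto `[{x>0, x²+y²≤1}, 2]`;
* `halfEllipse_sub_disc : of E - of D̄ ∈ relations` — with one integrand-additivity move and the
  moves of `disc_sub_two_prod`.
-/

noncomputable section

namespace Summit.KontsevichZagierPeriods.KontsevichZagierPeriods.Theorems

open Set MeasureTheory
open Literature.ModelTheory.ExponentialFields (IsSemialgebraic isSemialgebraic_setOf_eval_pos
  isSemialgebraic_setOf_eval_le isSemialgebraic_setOf_eval_lt)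
open MvPolynomial (aeval X)
open Literature.NumberTheory.Transcendental
open Literature.NumberTheory.Transcendental.KZ

namespace SoloBlind

/-! ## The one-dimensional factor `[(0,∞), 2/(1+u²)]` -/

/-- `T = [(0,∞), 2/(1+u²)]` (value `π`). -/
def twoAtanHalfLine : IntegralRep 1 :=
  lineRep (Ioi 0) (fun t => 2 / (1 + t ^ 2)) (isSemialgebraic_line_Ioi isAlgebraic_zero)
    (isSemialgebraicFunOn_atan_integrand (by simpa using isAlgebraic_nat (R := ℚ) (A := ℝ) 2)
      (isSemialgebraic_line_Ioi isAlgebraic_zero))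
    (IntegrableOn.congr_fun (integrableOn_inv_one_add_sq_Ioi.const_mul 2) (fun t _ => by
      show 2 * (1 / (1 + t ^ 2)) = 2 / (1 + t ^ 2)
      rw [mul_one_div]) measurableSet_Ioi)

/-- `value T = π`. -/
theorem twoAtanHalfLine_value : twoAtanHalfLine.value = Real.pi := by
  rw [twoAtanHalfLine, value_lineRep]
  have h : (fun t : ℝ => 2 / (1 + t ^ 2)) = fun t => (2:ℝ) * (1 / (1 + t ^ 2)) :=
    funext fun t => by rw [mul_one_div]
  have hP := arctanHalfLine_value
  rw [arctanHalfLine, value_lineRep] at hP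
  rw [h, integral_const_mul, hP]
  ring

/-- `T` has KZ's literal rational shape. -/
theorem isRational_twoAtanHalfLine : twoAtanHalfLine.IsRational :=
  ⟨2, 1 + X 0 ^ 2, fun x _ => by
    have : (0:ℝ) < 1 + x 0 ^ 2 := by positivity
    simpa using this.ne', fun x _ => by simp [twoAtanHalfLine]⟩

/-- `T ∈` the generators of `B(π)`. -/
theorem of_twoAtanHalfLine_mem_lineGens : of twoAtanHalfLine ∈ lineGens Real.pi :=
  ⟨1, twoAtanHalfLine, le_rfl, isRational_twoAtanHalfLine,
    ⟨0, 1, isAlgebraic_zero, isAlgebraic_one, by rw [twoAtanHalfLine_value]; ring⟩, rfl⟩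

/-- The slab `(0,∞) × (0,1]`. -/
def kzSlab : Set (Fin 2 → ℝ) := {z | 0 < z 0 ∧ (0 < z 1 ∧ z 1 ≤ 1)}

/-- Membership in the slab, unfolded. -/
theorem mem_kzSlab {z : Fin 2 → ℝ} : z ∈ kzSlab ↔ 0 < z 0 ∧ (0 < z 1 ∧ z 1 ≤ 1) := Iff.rfl

/-- The domain of `T × I` is the slab. -/
theorem prod_twoAtan_unitIoc_domain : (twoAtanHalfLine.prod unitIoc).domain = kzSlab := by
  ext z
  simp only [IntegralRep.prod_domain, IntegralRep.mem_prodDomain, twoAtanHalfLine, unitIoc,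
    lineRep_domain, mem_line, mem_Ioi, mem_Ioc,
    (show (Fin.castAdd 1 (0 : Fin 1) : Fin 2) = 0 from rfl),
    (show (Fin.natAdd 1 (0 : Fin 1) : Fin 2) = 1 from rfl)]
  exact Iff.rfl

/-- The integrand of `T × I` is `2/(1+u²)`. -/
theorem prod_twoAtan_unitIoc_integrand (z : Fin 2 → ℝ) :
    (twoAtanHalfLine.prod unitIoc).integrand z = 2 / (1 + z 0 ^ 2) := by
  rw [IntegralRep.prod_integrand_eq, IntegralRep.prodFun_apply]
  simp only [twoAtanHalfLine, unitIoc, lineRep_integrand,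
    (show (Fin.castAdd 1 (0 : Fin 1) : Fin 2) = 0 from rfl), mul_one]

/-! ## The two subgraph regions -/

/-- `{0 < y, 4x² + y² ≤ 4}`: the region under the graph of `2√(1-x²)`. -/
def kzHalfEllipse : Set (Fin 2 → ℝ) := {z | 0 < z 1 ∧ 4 * z 0 ^ 2 + z 1 ^ 2 ≤ 4}

/-- Membership in the half-ellipse, unfolded. -/
theorem mem_kzHalfEllipse {z : Fin 2 → ℝ} :
    z ∈ kzHalfEllipse ↔ 0 < z 1 ∧ 4 * z 0 ^ 2 + z 1 ^ 2 ≤ 4 := Iff.rfl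

/-- The half-ellipse is `ℚ`-semialgebraic. -/
theorem isSemialgebraic_kzHalfEllipse : IsSemialgebraic ℚ kzHalfEllipse := by
  have h : IsSemialgebraic ℚ {x : Fin 2 → ℝ |
      aeval x (4 * X 0 ^ 2 + X 1 ^ 2 : MvPolynomial (Fin 2) ℚ) ≤
        aeval x (4 : MvPolynomial (Fin 2) ℚ)} :=
    isSemialgebraic_setOf_eval_le _ _
  convert (isSemialgebraic_setOf_eval_pos (R := ℝ) (X 1 : MvPolynomial (Fin 2) ℚ)).inter h
    using 1
  ext z
  simp [kzHalfEllipse]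

/-- The half-ellipse is bounded. -/
theorem isBounded_kzHalfEllipse : Bornology.IsBounded kzHalfEllipse := by
  refine (Metric.isBounded_closedBall (x := (0 : Fin 2 → ℝ)) (r := 2)).subset fun z hz => ?_
  rw [mem_kzHalfEllipse] at hz
  rw [Metric.mem_closedBall, dist_zero_right, pi_norm_le_iff_of_nonneg zero_le_two]
  refine Fin.forall_fin_two.mpr ⟨?_, ?_⟩
  · rw [Real.norm_eq_abs, abs_le]
    constructor <;> nlinarith [sq_nonneg (z 1), sq_nonneg (z 0 + 2), sq_nonneg (z 0 - 2)]
  · rw [Real.norm_eq_abs, abs_le]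
    constructor <;> nlinarith [sq_nonneg (z 0), sq_nonneg (z 1 + 2), sq_nonneg (z 1 - 2)]

/-- **`E = [{0 < y, 4x² + y² ≤ 4}, 1]`**: `2∫_{-1}^{1} √(1-x²) dx` as a subgraph area. -/
def halfEllipseRep : IntegralRep 2 :=
  ratRep kzHalfEllipse (fun _ => 1) 1 1 isSemialgebraic_kzHalfEllipse (fun _ _ => by simp)
    (fun _ _ => by simp) (integrableOn_const isBounded_kzHalfEllipse.measure_lt_top.ne)

/-- `E` has KZ's literal rational shape. -/
theorem isRational_halfEllipseRep : halfEllipseRep.IsRational := isRational_ratRep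

/-- `[{x>0, x²+y²≤1}, 2]`. -/
def twoHalfDiscPosRep : IntegralRep 2 :=
  ratRep kzHalfDiscPos (fun _ => 2) 2 1 isSemialgebraic_kzHalfDiscPos (fun _ _ => by simp)
    (fun _ _ => by simp)
    (integrableOn_const ((isBounded_kzDisc.subset fun _ hz => hz.2).measure_lt_top.ne))

/-- `{x² < 1, 0 < y, y²(1-x²) ≤ 1}`: the region under the graph of `1/√(1-x²)` on `(-1,1)`. -/
def kzArcsine : Set (Fin 2 → ℝ) := {z | z 0 ^ 2 < 1 ∧ 0 < z 1 ∧ z 1 ^ 2 * (1 - z 0 ^ 2) ≤ 1}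

/-- Membership in the arcsine region, unfolded. -/
theorem mem_kzArcsine {z : Fin 2 → ℝ} :
    z ∈ kzArcsine ↔ z 0 ^ 2 < 1 ∧ 0 < z 1 ∧ z 1 ^ 2 * (1 - z 0 ^ 2) ≤ 1 := Iff.rfl

/-- The arcsine region is `ℚ`-semialgebraic. -/
theorem isSemialgebraic_kzArcsine : IsSemialgebraic ℚ kzArcsine := by
  have h1 : IsSemialgebraic ℚ {x : Fin 2 → ℝ |
      aeval x (X 0 ^ 2 : MvPolynomial (Fin 2) ℚ) < aeval x (1 : MvPolynomial (Fin 2) ℚ)} :=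
    isSemialgebraic_setOf_eval_lt _ _
  have h3 : IsSemialgebraic ℚ {x : Fin 2 → ℝ |
      aeval x (X 1 ^ 2 * (1 - X 0 ^ 2) : MvPolynomial (Fin 2) ℚ) ≤
        aeval x (1 : MvPolynomial (Fin 2) ℚ)} :=
    isSemialgebraic_setOf_eval_le _ _
  convert (h1.inter (isSemialgebraic_setOf_eval_pos (R := ℝ) (X 1 : MvPolynomial (Fin 2) ℚ))).inter
    h3 using 1
  ext z
  simp [kzArcsine, and_assoc]

/-! ## The linear chart `E → [{x>0,…}, 2]` -/

/-- **The chart `(x,y) ↦ (y/2, x)`**: `ℚ`-linear, injective, of the half-ellipse ONTO the right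
half-disc, `|det| = 1/2`. -/
theorem exists_ellipseChart :
    ∃ (Φ : (Fin 2 → ℝ) → (Fin 2 → ℝ)) (Φ' : (Fin 2 → ℝ) → (Fin 2 → ℝ) →L[ℝ] (Fin 2 → ℝ)),
      IsSemialgebraicMapOn ℚ kzHalfEllipse Φ ∧ (∀ z ∈ kzHalfEllipse, HasFDerivAt Φ (Φ' z) z) ∧
      InjOn Φ kzHalfEllipse ∧ Φ '' kzHalfEllipse = kzHalfDiscPos ∧
      (∀ z ∈ kzHalfEllipse, |(Φ' z).det| = 1 / 2) := by
  set Φ : (Fin 2 → ℝ) → (Fin 2 → ℝ) := fun z => ![z 1 / 2, z 0] with hΦ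
  set Φ' : (Fin 2 → ℝ) → (Fin 2 → ℝ) →L[ℝ] (Fin 2 → ℝ) :=
    fun _ => LinearMap.toContinuousLinearMap
      (Matrix.toLin' (!![0, 1 / 2; 1, 0] : Matrix (Fin 2) (Fin 2) ℝ)) with hΦ'
  have hΦ0 : ∀ z, Φ z 0 = z 1 / 2 := fun z => rfl
  have hΦ1 : ∀ z, Φ z 1 = z 0 := fun z => rfl
  have hΦ'0 : ∀ z v : Fin 2 → ℝ, Φ' z v 0 = 1 / 2 * v 1 := by
    intro z v
    change Matrix.toLin' (!![0, 1 / 2; 1, 0] : Matrix (Fin 2) (Fin 2) ℝ) v 0 = _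
    rw [Matrix.toLin'_apply]
    simp [Matrix.mulVec, dotProduct, Fin.sum_univ_two]
  have hΦ'1 : ∀ z v : Fin 2 → ℝ, Φ' z v 1 = v 0 := by
    intro z v
    change Matrix.toLin' (!![0, 1 / 2; 1, 0] : Matrix (Fin 2) (Fin 2) ℝ) v 1 = _
    rw [Matrix.toLin'_apply]
    simp [Matrix.mulVec, dotProduct, Fin.sum_univ_two]
  have hdet : ∀ z, (Φ' z).det = -(1 / 2) := by
    intro z
    change LinearMap.det (Matrix.toLin' (!![0, 1 / 2; 1, 0] : Matrix (Fin 2) (Fin 2) ℝ)) = _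
    rw [LinearMap.det_toLin', Matrix.det_fin_two]
    simp only [Matrix.of_apply, Matrix.cons_val', Matrix.cons_val_zero, Matrix.cons_val_one,
      Matrix.cons_val_fin_one, Matrix.empty_val']
    norm_num
  have hderiv : ∀ z, HasFDerivAt Φ (Φ' z) z := by
    intro z
    have h0 : HasFDerivAt (fun y : Fin 2 → ℝ => y 0)
        (ContinuousLinearMap.proj (R := ℝ) (φ := fun _ : Fin 2 => ℝ) 0) z := hasFDerivAt_apply 0 z
    have h1 : HasFDerivAt (fun y : Fin 2 → ℝ => y 1)
        (ContinuousLinearMap.proj (R := ℝ) (φ := fun _ : Fin 2 => ℝ) 1) z := hasFDerivAt_apply 1 z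
    rw [hasFDerivAt_pi']
    refine Fin.forall_fin_two.mpr ⟨?_, ?_⟩
    · have hf : (fun y : Fin 2 → ℝ => Φ y 0) = fun y => y 1 * 2⁻¹ :=
        funext fun y => by rw [hΦ0, div_eq_mul_inv]
      rw [hf]
      refine (h1.mul_const 2⁻¹).congr_fderiv (ContinuousLinearMap.ext fun v => ?_)
      simp [hΦ'0]
    · have hf : (fun y : Fin 2 → ℝ => Φ y 1) = fun y => y 0 := funext fun y => by rw [hΦ1]
      rw [hf]
      refine h0.congr_fderiv (ContinuousLinearMap.ext fun v => ?_)
      simp [hΦ'1]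
  refine ⟨Φ, Φ', ?_, fun z _ => hderiv z, ?_, ?_, fun z _ => by rw [hdet z]; norm_num⟩
  · refine IsSemialgebraicMapOn.of_forall isSemialgebraic_kzHalfEllipse
      (Fin.forall_fin_two.mpr ⟨?_, ?_⟩)
    · exact (isSemialgebraicFunOn_aeval_div_aeval isSemialgebraic_kzHalfEllipse (X 1) 2
        fun x _ => by simp).congr fun x _ => by simp [hΦ0]
    · exact (isSemialgebraicFunOn_aeval isSemialgebraic_kzHalfEllipse
        (X 0 : MvPolynomial (Fin 2) ℚ)).congr fun x _ => by simp [hΦ1]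
  · intro x _ y _ hxy
    have e0 := congrFun hxy 0
    have e1 := congrFun hxy 1
    simp only [hΦ0, hΦ1] at e0 e1
    funext i
    fin_cases i
    · exact e1
    · simpa using e0
  · ext w
    constructor
    · rintro ⟨z, hz, rfl⟩
      rw [mem_kzHalfEllipse] at hz
      rw [mem_kzHalfDiscPos]
      simp only [hΦ0, hΦ1]
      constructor
      · linarith [hz.1]
      · nlinarith [hz.2]
    · intro hw
      rw [mem_kzHalfDiscPos] at hw
      refine ⟨![w 1, 2 * w 0], ?_, ?_⟩
      · rw [mem_kzHalfEllipse]
        change 0 < 2 * w 0 ∧ 4 * w 1 ^ 2 + (2 * w 0) ^ 2 ≤ 4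
        constructor
        · linarith [hw.1]
        · nlinarith [hw.2]
      · funext i
        fin_cases i
        · change 2 * w 0 / 2 = w 0
          ring
        · rfl

/-- **Move (change of variables)**: `E ≡ [{x>0, x²+y²≤1}, 2]` — `1 = 2 · (1/2)`. -/
theorem equivalent_halfEllipse_twoHalfDisc : Equivalent halfEllipseRep twoHalfDiscPosRep := by
  obtain ⟨Φ, Φ', hsa, hderiv, hinj, himage, hdet⟩ := exists_ellipseChart
  exact equivalent_of_chart hsa hderiv hinj himage hdet (f := fun _ : Fin 2 → ℝ => (1 : ℝ))
    (g := fun _ : Fin 2 → ℝ => (2 : ℝ)) (fun _ _ => by norm_num) rfl (fun _ _ => rfl) rfl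
    (fun _ _ => rfl)

/-- Move (integrand additivity): `[K, 2] - 2·[K, 1]` is a relation. -/
theorem twoHalfDisc_sub_two_halfDisc :
    of twoHalfDiscPosRep - 2 • of halfDiscPosRep ∈ relations :=
  of_sub_nsmul_mem_relations 2 rfl fun _ _ => by
    show (2:ℝ) = ((2:ℕ):ℝ) * 1
    norm_num

/-- **`[E] - [D̄] ∈ relations`**: the half-ellipse area and the disc area are KZ-equivalent by
finitely many moves (chart, integrand additivity, and the moves of `disc_sub_two_prod`). -/
theorem halfEllipse_sub_disc : of halfEllipseRep - of discRep ∈ relations := by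
  have h := sub_mem (add_mem (add_mem equivalent_halfEllipse_twoHalfDisc
    twoHalfDisc_sub_two_halfDisc) (nsmul_mem equivalent_halfDiscPos_prod 2)) disc_sub_two_prod
  convert h using 1
  rw [smul_sub]
  abel

end SoloBlind

end Summit.KontsevichZagierPeriods.KontsevichZagierPeriods.Theorems
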